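import Mathlib
import Literature.AlgebraicGeometry.Resolution.AffineDomainEquidim

/-!
# TropicalLinks / SchonResolves — a hypersurface section of an affine domain drops the dimension by one

Route `ResolutionOfSingularities/TropicalLinks`, crux `SchonResolves` (stmt-ResolutionOfSingularities-17234),
line `zariski-toric-closure`, stub DIM-3core (dimension of initial degenerations: the special
fibre `A_t ⧸ (t)` of the Gröbner family `A_t`, an affine domain of dimension `d + 1`, has
dimension `d`).

* `schonResolves_ringKrullDim_quotient_span_singleton_of_isDomain` (DIM-3core) — for a domain
  `A` of finite type over a field `k` with `dim A = d + 1` and a non-zero non-unit `t ∈ A`,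
  `dim A ⧸ (t) = d`.

Proof: `t` is a non-zero-divisor lying in some maximal ideal `𝔪`; maximal ideals of affine
domains have height `dim A` (tree `height_eq_ringKrullDim_of_isMaximal`, Matsumura §5
Thm. 5.6 / Ex. 5.1), and for a non-zero-divisor `r` in a prime of height `dim A` of a
Noetherian ring Mathlib gives `dim A ⧸ (r) + 1 = dim A`
(`Module.ringKrullDim_quotient_add_one_of_mem_nonZeroDivisors`, Krull's principal ideal
theorem for `≥` and the non-zero-divisor bound for `≤`).  Standard material (Hartshorne,
*Algebraic Geometry*, I Prop. 1.13 and Ex. 1.8; Matsumura, *Commutative Ring Theory*, §5);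
no new definitions.
-/

-- single-problem summit: the doubled namespace component `ResolutionOfSingularities` is forced
set_option linter.dupNamespace false

namespace Summit.ResolutionOfSingularities.ResolutionOfSingularities.Theorems

/-- **A hypersurface section of an affine domain drops the dimension by exactly one**
(DIM-3core): for a domain `A` of finite type over a field `k` with `dim A = d + 1` and a
non-zero non-unit `t ∈ A`, `dim (A ⧸ (t)) = d`.  (`t` is a non-zero-divisor in a maximal
ideal, which has height `dim A` since affine domains are equidimensional at closed points;
then `dim A ⧸ (t) + 1 = dim A`.) [cite: Matsumura1987, §5 Thm. 5.6 and Ex. 5.1] -/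
theorem schonResolves_ringKrullDim_quotient_span_singleton_of_isDomain : ∀ (k : Type) [Field k]
    (A : Type) [CommRing A] [IsDomain A] [Algebra k A] [Algebra.FiniteType k A] (d : ℕ),
    ringKrullDim A = ((d + 1 : ℕ) : WithBot ℕ∞) → ∀ (t : A), t ≠ 0 → ¬ IsUnit t →
      ringKrullDim (A ⧸ Ideal.span {t}) = (d : WithBot ℕ∞) := by
  intro k _ A _ _ _ _ d hdim t ht0 htu
  haveI : IsNoetherianRing A := Algebra.FiniteType.isNoetherianRing k A
  -- `t` lies in a maximal ideal `𝔪`, of height `dim A`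
  obtain ⟨m, hm, htm⟩ := Ideal.exists_le_maximal (Ideal.span {t}) (Ideal.span_singleton_ne_top htu)
  have htm' : t ∈ m := htm (Ideal.mem_span_singleton_self t)
  have hh : (m.height : WithBot ℕ∞) = ringKrullDim A :=
    Literature.AlgebraicGeometry.Resolution.height_eq_ringKrullDim_of_isMaximal k m
  -- `dim A ⧸ (t) + 1 = dim A = d + 1`
  have h := Module.ringKrullDim_quotient_add_one_of_mem_nonZeroDivisors
    (mem_nonZeroDivisors_of_ne_zero ht0) hh htm'
  rw [hdim] at h
  -- cancel the `+ 1` in `WithBot ℕ∞`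
  revert h
  generalize ringKrullDim (A ⧸ Ideal.span {t}) = x
  intro h
  induction x using WithBot.recBotCoe with
  | bot =>
    rw [WithBot.bot_add] at h
    exact absurd h (WithBot.bot_ne_natCast (d + 1))
  | coe x =>
    induction x using ENat.recTopCoe with
    | top =>
      have h1 : (⊤ : ℕ∞) + 1 = ((d + 1 : ℕ) : ℕ∞) := by exact_mod_cast h
      rw [top_add] at h1
      exact absurd h1 (ENat.top_ne_coe (d + 1))
    | coe n =>
      have h1 : n + 1 = d + 1 := by exact_mod_cast h
      have h2 : n = d := by omega
      subst h2
      rfl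

end Summit.ResolutionOfSingularities.ResolutionOfSingularities.Theorems
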